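import Summits.BirchSwinnertonDyer.Rank1Residual.X11b.CastellaErratumTreeFacts
import Mathlib.NumberTheory.NumberField.ClassNumber
import HarnessLib

/-!
# X11b, route R1 — the (c)-congruence's standing hypotheses DISPLAYED: `D_K` odd and `p ∤ h_K` (query Q6, answered by the literature seat 2026-08-20)

HONEST FRAMING (cell `b2b-bsdres`, run/shared/lean/b2b/bsd-rank1-residual/, verbatim in every
file): the goal of the cell is to DELETE the COMBINATION-SHAPED residual classes of the
Birch–Swinnerton-Dyer formula for ALL analytic-rank `≤ 1` elliptic curves over `ℚ` — "full BSD
formula for every rank `≤ 1` curve in class `C`" assembled STRICTLY from published theorems — so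
that the rank-`≤ 1` remainder becomes exactly the CONSTRUCTION-SHAPED classes, which are TYPED
(missing-input `Prop`s), NOT attempted. This is not "finishing BSD". Sub-cell
`b2b-bsdres-multr1-p1` (X11b, route R1); no claim beyond the stated class; X11b stays
CONSTRUCTION-SHAPED; nothing here changes a label; no named fact (theorems only; no `sorry`; no
claim that any published or announced theorem is false).

## What is displayed, and why

Route R1's end form `routeGoal_of_display_of_treeFacts` (`CastellaErratumTreeFacts.lean`) reads:
EIGHT published named facts + the ONE open input (A) ⇒ `RouteGoal`, where (A) is "Castella's
display (5.3) at every Heegner datum with `p ∤ c(Dt)` over an ERRATUM FIELD `K`" and its printed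
derivation is (A) ⇐ [Cas18, Thms. 2.3, 3.2] ∘ erratum Thm. 1.1 ⇐ erratum Thm. 2.3 (⇐ [FW21,
Thm. 4.41], PREPRINT) + Hida theory (a), (b) + **(c) "an equality
`(L^Σ_p(g_m), p^m) = (L^Σ_p(f), p^m) ⊂ Λ_𝒪^{ur}` … (c) follows from [Cas20, Thm. 2.11]"**
(erratum p. 4). The literature seat's reading of record (lit GEN 18, READINGS-g18 R6; flag
`Cas18err-(c)-oddD-hK`): [Cas20] = F. Castella, *On the `p`-adic variation of Heegner points*,
J. Inst. Math. Jussieu 19 (2020) 2127–2164 = arXiv:1410.6591, states its §2 — in particular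
Thm. 2.11, the two-variable `p`-adic `L`-function `𝓛_{𝔭,ξ}(𝐟)` behind (c) — under the RUNNING
HYPOTHESES of §2.2 "CM points" (arXiv p. 5, ll. 51–57), verbatim:

> "Let `K = ℚ(√−D)` be an imaginary quadratic field in which the prime `p` splits … In
> addition, we assume that `D` is odd, that `p` does not divide the class number of `K`, and that
> there is an ideal `𝔑 ⊂ 𝒪` with `𝒪/𝔑 ≅ ℤ/Nℤ` which we fix from now on."

whereas the erratum's Thm. 1.1 allows `2` to ramify in `K` when `2 ∥ N` (hypothesis (ii)) and
carries no `p ∤ h_K` clause: Thm. 1.1 is stated more widely than its cited input (c). (Whether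
`p ∤ h_K` is essential to [Cas20, Thm. 2.11] — §2.3, arXiv p. 10 l. 9, says "for simplicity" for a
related assumption — is for the literature seat / the author; note also erratum p. 4: by
[FO12, Cor. 7.2.1] `L^Gr_p(g)` "agrees (up to a unit) with the product of a two-variable Hida
`p`-adic Rankin `L`-series, an anticyclotomic Katz `p`-adic `L`-function, and the class number of
`K`".) This file therefore DISPLAYS both conditions on the field where (c) is consumed:

* `IsErratumField.splitsIn_two`, `IsErratumField.not_two_dvd_discr`,
  `IsErratumField.not_two_dvd_discr_iff` — on an erratum field for the nonsplit ramified prime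
  `q` (`IsErratumField W K q`: `q ∣ d_K`, every other `ℓ ∣ N` split, `2` split if `2 ∤ N`) the
  discriminant is ODD iff `q ≠ 2` (for `q ≠ 2` the prime `2` splits, hence is unramified,
  `not_dvd_discr_of_splitsIn`). So "`D` odd" costs exactly the pairs whose nonsplit ramified
  multiplicative primes are all `= 2`, and is automatic otherwise;
* `bsdp_of_display_hK` — **per pair: `BSD(E,p)` on `ChainLocus` with an ODD nonsplit ramified
  `q`, from the eight published facts, the open input (A♭) = (A) assumed ONLY over erratum fields
  with `2 ∤ d_K` and `p ∤ h_K` (the fields where (c) is printed), and a GIVEN erratum field `K` for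
  `q` with `p ∤ h_K`;**
* `forall_bsdp_of_display_hK_of_supply` — the class-level form: the same with the field supplied
  by an explicit input `hSupply` ("for every such pair and odd `q` there is an erratum field with
  `p ∤ h_K`", i.e. an imaginary quadratic `K` with `q` ramified, the other primes of `N` split,
  `p ∤ h_K` AND `L(E^{(d_K)},1) ≠ 0`). STATUS of `hSupply`: NOT a published theorem as far as this
  seat's presearch goes — Friedberg–Hoffstein 1995 Thm. B (the tree's
  `friedbergHoffstein_exists_twist_ne_zero_ramifiedAt`) gives the splitting and `L(E^D,1) ≠ 0` but
  no class-number control; Kohnen–Ono, Invent. Math. 135 (1999) / Wiles, *On class groups of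
  imaginary quadratic fields*, JLMS 92 (2015) / Beckwith, Res. Number Theory 3 (2017)
  (arXiv:1612.04443, Thm. (Wiles) and Cor. 1.2) give `p ∤ h(D)` with prescribed splitting (under
  congruence provisos on the prescribed primes: ramified `q ≢ 1 (mod p)`, split `ℓ ≢ −1 (mod p)`)
  but no `L`-value; Davenport–Heilbronn / Horie–Nakagawa / Vatsal 1998 / Byeon combine both only
  at `p = 3`. It is displayed, not asserted;
* `forall_bsdp_of_display_oddDisc` — if only "`D` odd" is displayed (should `p ∤ h_K` prove
  inessential to (c)), NO new supply is needed: the Friedberg–Hoffstein field already has odd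
  discriminant for `q ≠ 2`, so the eight published facts + (A) restricted to odd-discriminant
  erratum fields give `BSD(E,p)` on `ChainLocus ∩ {an odd nonsplit ramified q}`;
* (bookkeeping) the old input (A) (all erratum fields) trivially implies (A♭): two hypotheses
  are ignored.

Net effect on R1's ledger (bookkeeping, labels unchanged): on `ChainLocus ∩ {odd q}` the route
reads EIGHT PUB + (A♭) [OPEN: ⇐ Thm. 1.1 ⇐ FW21 4.41 + (c) under Cas20's printed hypotheses] +
`hSupply` [an erratum field with `p ∤ h_K`: not in print]; the `q = 2` corner of `ChainLocus`
(the only nonsplit ramified multiplicative prime is `2`) is outside Cas20's "`D` odd".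

References: [Castella2018Erratum] Thm. 1.1, proof (p. 4) items (a)–(c); [Castella2020JIMJ]
(bib key added by this seat) §2.2 (arXiv:1410.6591 p. 5) and Thm. 2.11; [Castella2018] §5; [FriedbergHoffstein1995] Thm. B;
[KohnenOno1999]; Beckwith arXiv:1612.04443 (Wiles 2015 quoted there).
-/

noncomputable section

open scoped Classical

open WeierstrassCurve NumberField Literature.NumberTheory.EllipticCurves
  Literature.NumberTheory.EllipticCurves.ModularForms
  Literature.NumberTheory.EllipticCurves.Rank1Residual

namespace Summit.BirchSwinnertonDyer.Rank1Residual.X11b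

/-! ### `D_K` odd on an erratum field ⟺ the ramified prime `q` is odd -/

section Discr

variable {W : WeierstrassCurve ℚ} {K : Type} [Field K] [NumberField K] {q : ℕ}

/-- On an erratum field for `q ≠ 2` the prime `2` splits: if `2 ∣ N` it is "another prime of
`N`" (all split), if `2 ∤ N` hypothesis (ii) of the erratum makes it split. [cite: Castella2018Erratum, Thm. 1.1 (ii)–(iii)] -/
theorem IsErratumField.splitsIn_two (hK : IsErratumField W K q) (hq2 : q ≠ 2) : SplitsIn K 2 := by
  by_cases h2N : 2 ∣ W.conductorNorm ℤ
  · exact hK.2.2.1 2 Nat.prime_two h2N (Ne.symm hq2)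
  · exact hK.2.2.2.1 h2N

/-- **`D_K` is odd on an erratum field for an odd `q`** (the prime `2` splits, hence is
unramified: `not_dvd_discr_of_splitsIn`) — Cas20's running hypothesis "`D` is odd" is automatic
there. [cite: Castella2018Erratum, Thm. 1.1 (ii)] -/
theorem IsErratumField.not_two_dvd_discr (hK : IsErratumField W K q) (hq2 : q ≠ 2) :
    ¬ (2 : ℤ) ∣ NumberField.discr K := by
  have h := not_dvd_discr_of_splitsIn hK.1.1 Nat.prime_two (hK.splitsIn_two hq2)
  exact_mod_cast h

/-- On an erratum field for `q = 2` the discriminant is even (`q ∣ d_K`). [folklore] -/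
theorem IsErratumField.two_dvd_discr (hK : IsErratumField W K 2) : (2 : ℤ) ∣ NumberField.discr K := by
  exact_mod_cast hK.2.1

/-- **`D_K` odd ⟺ `q ≠ 2`** on an erratum field for the prime `q`: Cas20's "`D` odd" costs exactly
the erratum fields ramified at `q = 2`. [folklore] -/
theorem IsErratumField.not_two_dvd_discr_iff (hK : IsErratumField W K q) [Fact q.Prime] :
    ¬ (2 : ℤ) ∣ NumberField.discr K ↔ q ≠ 2 := by
  refine ⟨fun h hq ↦ h ?_, hK.not_two_dvd_discr⟩
  subst hq
  exact hK.two_dvd_discr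

end Discr

/-! ### The end form with `D_K` odd and `p ∤ h_K` displayed on the open input -/

section EndForm

/-- **Per pair, with a GIVEN field: `BSD(E,p)` on `ChainLocus` at an odd nonsplit ramified `q`
from EIGHT published named facts, the displayed open input (A♭), and an erratum field `K` for `q`
with `p ∤ h_K`.** Inputs: `hGZ` (Gross–Zagier I.7.3), `hGZK` (Gross–Zagier–Kolyvagin over `ℚ`),
`hSk` (Skinner 2016 Thm. C), `hmod` (modularity), `hCST` (Cai–Shu–Tian 2014 Thm. 1.1), `hMaz`
(Mazur 1978 Cor. 4.1), `hNS` (Néron mapping property) — PUBLISHED —; `hA` = (A♭) — OPEN: the display (5.3) at data with `p ∤ c` over erratum fields with `2 ∤ d_K` and `p ∤ h_K` —; the pair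
`(W,p)` on `ChainLocus` with `ord_{s=1}L(E,s) = 1`; an ODD prime `q ≠ p` of nonsplit multiplicative
reduction with `p ∤ v_q(Δ)`; an erratum field `K` for `q` with `p ∤ h_K` (its discriminant is then
odd, `IsErratumField.not_two_dvd_discr`). Proof = the body of `routeGoal_of_links_datum` with the
field taken as given: Manin datum (`maninPackage_of_neronScaling`), Heegner point of the datum
(`heegnerDatumSupply_of_caiShuTian` with the Cai–Shu–Tian binders discharged by the tree), twist
transports, the second ramified multiplicative prime `ℓ ≠ q` from `ChainLocus` (one of its two
witnesses differs from `q`), links (B) `gzParaphraseAt_of_datum`, (C)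
`tamagawaDescentAt_of_isErratumField`, and `bsdp_of_links`. CONDITIONAL on (A♭); deletes nothing.
[cite: Castella2018, §5 (arXiv:1704.06608 p. 12)] [cite: Castella2018Erratum, Thm. 1.1, Thm. A′ and proof of Thm. 1.1 (p. 4) (c)]
[cite: Castella2020JIMJ, §2.2 running hypotheses (arXiv:1410.6591 p. 5, ll. 51–57) and Thm. 2.11] -/
theorem bsdp_of_display_hK
    (hGZ : GrossZagier1986_thm_I_7_3) (hGZK : rank_eq_analyticRank_of_analyticRank_le_one)
    (hSk : Skinner2016.thmC_padicValRat_bsd_rank_zero) (hmod : exists_isNewformOf)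
    (hCST : CaiShuTian2014.thm11_trivialChar)
    (hMaz : mazur_not_dvd_maninConstant_of_odd) (hNS : integral_neronScaling_of_isGloballyMinimal)
    (hA : ∀ (W : WeierstrassCurve ℚ) [W.IsElliptic] [W.IsGloballyMinimal] [NeZero (W.conductorNorm ℤ)]
        (p : ℕ) [Fact p.Prime] (q : ℕ) [Fact q.Prime] (K : Type) [Field K] [NumberField K]
        (Dt : ModularParametrizationData W (W.conductorNorm ℤ))
        (H : HeegnerDatum (W.conductorNorm ℤ) (NumberField.discr K)) (ι : K →+* ℂ)
        (P : (W.baseChange K).toAffine.Point),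
        ErratumHypotheses W p → W.analyticRank = 1 → q ≠ p → Mult W q →
        ¬ W.HasSplitMultiplicativeReductionAtPrime q → ¬ p ∣ padicValInt q W.minimalDiscriminantInt →
        IsErratumField W K q → ¬ (2 : ℤ) ∣ NumberField.discr K → ¬ p ∣ NumberField.classNumber K →
        WeierstrassCurve.Affine.Point.map ι.toRatAlgHom P = heegnerPointComplex Dt H →
        ¬ (p : ℤ) ∣ Dt.c → ¬ IsOfFinAddOrder P → Display53At W p K P)
    (W : WeierstrassCurve ℚ) [W.IsElliptic] [W.IsGloballyMinimal] (p : ℕ) [Fact p.Prime]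
    (hCL : ChainLocus W p) (hr : W.analyticRank = 1)
    (q : ℕ) [Fact q.Prime] (hq2 : q ≠ 2) (hqp : q ≠ p) (hmq : Mult W q)
    (hnsq : ¬ W.HasSplitMultiplicativeReductionAtPrime q)
    (hvq : ¬ p ∣ padicValInt q W.minimalDiscriminantInt)
    (K : Type) [Field K] [NumberField K] (hKf : IsErratumField W K q)
    (hhK : ¬ p ∣ NumberField.classNumber K) :
    BSDp W p := by
  have hE : ErratumHypotheses W p := hCL.erratumHypotheses
  haveI : NeZero (W.conductorNorm ℤ) := ⟨(W.conductorNorm_pos_holds).ne'⟩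
  have hmodE : hasEntireLFunction_rat := hasEntireLFunction_rat_of_exists_isNewformOf hmod
  -- a second ramified multiplicative prime `ℓ ∉ {p, q}` from `ChainLocus`
  obtain ⟨ℓ, hℓF, hℓp, hℓq, hmℓ, hvℓ⟩ : ∃ (ℓ : ℕ) (_ : Fact ℓ.Prime), ℓ ≠ p ∧ ℓ ≠ q ∧ Mult W ℓ ∧
      ¬ p ∣ padicValInt ℓ W.minimalDiscriminantInt := by
    obtain ⟨⟨q₀, hq₀F, ℓ₀, hℓ₀F, hq₀p, hℓ₀p, hℓ₀q₀, hmq₀, -, hvq₀, hmℓ₀, hvℓ₀⟩, -⟩ := hCL.2.2.2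
    by_cases h : q₀ = q
    · subst h
      exact ⟨ℓ₀, hℓ₀F, hℓ₀p, hℓ₀q₀, hmℓ₀, hvℓ₀⟩
    · exact ⟨q₀, hq₀F, hq₀p, h, hmq₀, hvq₀⟩
  -- the displayed side conditions on `K`
  have hDodd : ¬ (2 : ℤ) ∣ NumberField.discr K := hKf.not_two_dvd_discr hq2
  -- a datum with Manin constant prime to `p`, its Heegner point
  obtain ⟨Dt, hc⟩ := maninPackage_of_neronScaling hmod hMaz hNS W p hE hr
  obtain ⟨H, ι, P, hP, hnt⟩ :=
    heegnerDatumSupply_of_caiShuTian W hmodE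
      (CaiShuTian2014.exists_isHeegnerPoint_of_heegnerCondition_of_modularity
        (nonempty_modularParametrizationData_iff_exists_isNewformOf_unconditional.mpr hmod))
      CaiShuTian2014.exists_map_eq_heegnerPointComplex_of_heegnerCondition_holds hCST hr hmq hnsq
      hKf Dt
  -- a globally minimal model of the twist and the transports
  have hd0 : (NumberField.discr K : ℚ) ≠ 0 := by exact_mod_cast NumberField.discr_ne_zero K
  haveI := W.isElliptic_quadraticTwist hd0
  obtain ⟨C, hCmin⟩ := hasGlobalMinimalModel_rat_holds (W.quadraticTwist (NumberField.discr K : ℚ))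
  set Wd := C • W.quadraticTwist (NumberField.discr K : ℚ) with hWd_def
  haveI : Wd.IsGloballyMinimal := hCmin
  have hWd : ∃ C' : VariableChange ℚ, C' • W.quadraticTwist (NumberField.discr K : ℚ) = Wd :=
    ⟨C, rfl⟩
  obtain ⟨htm, hti, htr⟩ := twistTransportAt_of_twist W p hKf.1 Wd hWd
  have hsp : SplitsIn K p := hKf.splitsIn_of_mult hE.2.1 (Ne.symm hqp)
  have hsℓ : SplitsIn K ℓ := hKf.splitsIn_of_mult hmℓ hℓq
  have hmultd : Mult Wd p := htm hsp hE.2.1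
  have hirrd : Irr Wd p := hti hE.2.2.1
  obtain ⟨hmℓd, hvℓd⟩ := htr ℓ hℓp hsℓ hmℓ hvℓ
  have hLd : Wd.entireLFunction 1 ≠ 0 := by
    rw [hWd_def, WeierstrassCurve.entireLFunction_smul]
    exact hKf.2.2.2.2
  -- links (A♭) [input], (B), (C) [tree theorems] and the bookkeeping
  exact bsdp_of_links W p hGZ hGZK hSk hE.1 hE.2.2.1 hr K hKf.1 Wd hWd hLd hmultd hirrd
    ⟨ℓ, hℓF, hℓp, hmℓd, hvℓd⟩ P
    (hA W p q K Dt H ι P hE hr hqp hmq hnsq hvq hKf hDodd hhK hP hc hnt)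
    (gzParaphraseAt_of_datum W p hE.1 hGZK hmodE hCST hr hE.2.2.1 hmq hnsq hKf hsp Dt H ι P hP hc
      hnt Wd (Cd := C) rfl)
    (tamagawaDescentAt_of_isErratumField W p hE.1 q hmq hvq K hKf Wd hWd)

/-- **Class level, with the field supply as an explicit input: `BSD(E,p)` for every rank-one pair
on `ChainLocus` having an ODD nonsplit ramified multiplicative `q`, from EIGHT published named
facts + (A♭) [OPEN] + `hSupply` [an erratum field with `p ∤ h_K` — NOT a published theorem:
Friedberg–Hoffstein gives the splitting and `L(E^D,1) ≠ 0`, Kohnen–Ono / Wiles 2015 / Beckwith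
2017 give `p ∤ h(D)` with splitting but no `L`-value].** This is `routeGoal_of_display_of_treeFacts`
with the (c)-congruence's running hypotheses ([Cas20] §2.2: "`D` is odd, … `p` does not divide the
class number of `K`") displayed where they are consumed. CONDITIONAL; deletes nothing; X11b stays
CONSTRUCTION-SHAPED. [cite: Castella2018Erratum, Thm. 1.1 and proof (p. 4) (c)]
[cite: Castella2018, §5 (arXiv:1704.06608 p. 12)]
[cite: Castella2020JIMJ, §2.2 running hypotheses (arXiv:1410.6591 p. 5, ll. 51–57) and Thm. 2.11] -/
theorem forall_bsdp_of_display_hK_of_supply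
    (hGZ : GrossZagier1986_thm_I_7_3) (hGZK : rank_eq_analyticRank_of_analyticRank_le_one)
    (hSk : Skinner2016.thmC_padicValRat_bsd_rank_zero) (hmod : exists_isNewformOf)
    (hCST : CaiShuTian2014.thm11_trivialChar)
    (hMaz : mazur_not_dvd_maninConstant_of_odd) (hNS : integral_neronScaling_of_isGloballyMinimal)
    (hA : ∀ (W : WeierstrassCurve ℚ) [W.IsElliptic] [W.IsGloballyMinimal] [NeZero (W.conductorNorm ℤ)]
        (p : ℕ) [Fact p.Prime] (q : ℕ) [Fact q.Prime] (K : Type) [Field K] [NumberField K]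
        (Dt : ModularParametrizationData W (W.conductorNorm ℤ))
        (H : HeegnerDatum (W.conductorNorm ℤ) (NumberField.discr K)) (ι : K →+* ℂ)
        (P : (W.baseChange K).toAffine.Point),
        ErratumHypotheses W p → W.analyticRank = 1 → q ≠ p → Mult W q →
        ¬ W.HasSplitMultiplicativeReductionAtPrime q → ¬ p ∣ padicValInt q W.minimalDiscriminantInt →
        IsErratumField W K q → ¬ (2 : ℤ) ∣ NumberField.discr K → ¬ p ∣ NumberField.classNumber K →
        WeierstrassCurve.Affine.Point.map ι.toRatAlgHom P = heegnerPointComplex Dt H →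
        ¬ (p : ℤ) ∣ Dt.c → ¬ IsOfFinAddOrder P → Display53At W p K P)
    (hSupply : ∀ (W : WeierstrassCurve ℚ) [W.IsElliptic] [W.IsGloballyMinimal] (p : ℕ) [Fact p.Prime]
        (q : ℕ) [Fact q.Prime],
        ErratumHypotheses W p → W.analyticRank = 1 → q ≠ 2 → q ≠ p → Mult W q →
        ¬ W.HasSplitMultiplicativeReductionAtPrime q → ¬ p ∣ padicValInt q W.minimalDiscriminantInt →
        ∃ (K : Type) (_ : Field K) (_ : NumberField K),
          IsErratumField W K q ∧ ¬ p ∣ NumberField.classNumber K) :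
    ∀ (W : WeierstrassCurve ℚ) [W.IsElliptic] [W.IsGloballyMinimal] (p : ℕ) [Fact p.Prime],
      ChainLocus W p →
      (∃ (q : ℕ) (_ : Fact q.Prime), q ≠ 2 ∧ q ≠ p ∧ Mult W q ∧
        ¬ W.HasSplitMultiplicativeReductionAtPrime q ∧ ¬ p ∣ padicValInt q W.minimalDiscriminantInt) →
      W.analyticRank = 1 → BSDp W p := by
  intro W _ _ p _ hCL ⟨q, hqF, hq2, hqp, hmq, hnsq, hvq⟩ hr
  obtain ⟨K, _, _, hKf, hhK⟩ := hSupply W p q hCL.erratumHypotheses hr hq2 hqp hmq hnsq hvq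
  exact bsdp_of_display_hK hGZ hGZK hSk hmod hCST hMaz hNS hA W p hCL hr q hq2 hqp hmq hnsq hvq K hKf
    hhK

/-- **If only "`D` odd" is displayed, no new supply is needed.** With (A) assumed over erratum
fields of ODD discriminant (no class-number clause) and the Friedberg–Hoffstein field supply
(`hFH`, PUBLISHED; its field has odd discriminant for `q ≠ 2`, `IsErratumField.not_two_dvd_discr`):
`BSD(E,p)` for every rank-one pair on `ChainLocus` with an odd nonsplit ramified multiplicative
`q`, from NINE published named facts + that open input. Isolates `p ∤ h_K` as the single delta of
query Q6. CONDITIONAL; deletes nothing. [cite: Castella2018Erratum, Thm. 1.1 (ii)]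
[cite: FriedbergHoffstein1995, Thm. B (special case)] -/
theorem forall_bsdp_of_display_oddDisc
    (hGZ : GrossZagier1986_thm_I_7_3) (hGZK : rank_eq_analyticRank_of_analyticRank_le_one)
    (hSk : Skinner2016.thmC_padicValRat_bsd_rank_zero) (hmod : exists_isNewformOf)
    (hCST : CaiShuTian2014.thm11_trivialChar)
    (hFH : friedbergHoffstein_exists_twist_ne_zero_ramifiedAt)
    (hMaz : mazur_not_dvd_maninConstant_of_odd) (hNS : integral_neronScaling_of_isGloballyMinimal)
    (hA : ∀ (W : WeierstrassCurve ℚ) [W.IsElliptic] [W.IsGloballyMinimal] [NeZero (W.conductorNorm ℤ)]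
        (p : ℕ) [Fact p.Prime] (q : ℕ) [Fact q.Prime] (K : Type) [Field K] [NumberField K]
        (Dt : ModularParametrizationData W (W.conductorNorm ℤ))
        (H : HeegnerDatum (W.conductorNorm ℤ) (NumberField.discr K)) (ι : K →+* ℂ)
        (P : (W.baseChange K).toAffine.Point),
        ErratumHypotheses W p → W.analyticRank = 1 → q ≠ p → Mult W q →
        ¬ W.HasSplitMultiplicativeReductionAtPrime q → ¬ p ∣ padicValInt q W.minimalDiscriminantInt →
        IsErratumField W K q → ¬ (2 : ℤ) ∣ NumberField.discr K →
        WeierstrassCurve.Affine.Point.map ι.toRatAlgHom P = heegnerPointComplex Dt H →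
        ¬ (p : ℤ) ∣ Dt.c → ¬ IsOfFinAddOrder P → Display53At W p K P) :
    ∀ (W : WeierstrassCurve ℚ) [W.IsElliptic] [W.IsGloballyMinimal] (p : ℕ) [Fact p.Prime],
      ChainLocus W p →
      (∃ (q : ℕ) (_ : Fact q.Prime), q ≠ 2 ∧ q ≠ p ∧ Mult W q ∧
        ¬ W.HasSplitMultiplicativeReductionAtPrime q ∧ ¬ p ∣ padicValInt q W.minimalDiscriminantInt) →
      W.analyticRank = 1 → BSDp W p := by
  intro W _ _ p _ hCL ⟨q, hqF, hq2, hqp, hmq, hnsq, hvq⟩ hr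
  obtain ⟨K, _, _, hKf⟩ := erratumField_supply hmod hFH W p q hr hmq hnsq
  -- run `bsdp_of_display_hK` with a vacuous class-number clause: instantiate (A♭) from `hA`
  -- at THIS field by ignoring `p ∤ h_K` (we do not have it and do not use it)
  have hE : ErratumHypotheses W p := hCL.erratumHypotheses
  haveI : NeZero (W.conductorNorm ℤ) := ⟨(W.conductorNorm_pos_holds).ne'⟩
  have hmodE : hasEntireLFunction_rat := hasEntireLFunction_rat_of_exists_isNewformOf hmod
  obtain ⟨ℓ, hℓF, hℓp, hℓq, hmℓ, hvℓ⟩ : ∃ (ℓ : ℕ) (_ : Fact ℓ.Prime), ℓ ≠ p ∧ ℓ ≠ q ∧ Mult W ℓ ∧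
      ¬ p ∣ padicValInt ℓ W.minimalDiscriminantInt := by
    obtain ⟨⟨q₀, hq₀F, ℓ₀, hℓ₀F, hq₀p, hℓ₀p, hℓ₀q₀, hmq₀, -, hvq₀, hmℓ₀, hvℓ₀⟩, -⟩ := hCL.2.2.2
    by_cases h : q₀ = q
    · subst h
      exact ⟨ℓ₀, hℓ₀F, hℓ₀p, hℓ₀q₀, hmℓ₀, hvℓ₀⟩
    · exact ⟨q₀, hq₀F, hq₀p, h, hmq₀, hvq₀⟩
  have hDodd : ¬ (2 : ℤ) ∣ NumberField.discr K := hKf.not_two_dvd_discr hq2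
  obtain ⟨Dt, hc⟩ := maninPackage_of_neronScaling hmod hMaz hNS W p hE hr
  obtain ⟨H, ι, P, hP, hnt⟩ :=
    heegnerDatumSupply_of_caiShuTian W hmodE
      (CaiShuTian2014.exists_isHeegnerPoint_of_heegnerCondition_of_modularity
        (nonempty_modularParametrizationData_iff_exists_isNewformOf_unconditional.mpr hmod))
      CaiShuTian2014.exists_map_eq_heegnerPointComplex_of_heegnerCondition_holds hCST hr hmq hnsq
      hKf Dt
  have hd0 : (NumberField.discr K : ℚ) ≠ 0 := by exact_mod_cast NumberField.discr_ne_zero K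
  haveI := W.isElliptic_quadraticTwist hd0
  obtain ⟨C, hCmin⟩ := hasGlobalMinimalModel_rat_holds (W.quadraticTwist (NumberField.discr K : ℚ))
  set Wd := C • W.quadraticTwist (NumberField.discr K : ℚ) with hWd_def
  haveI : Wd.IsGloballyMinimal := hCmin
  have hWd : ∃ C' : VariableChange ℚ, C' • W.quadraticTwist (NumberField.discr K : ℚ) = Wd :=
    ⟨C, rfl⟩
  obtain ⟨htm, hti, htr⟩ := twistTransportAt_of_twist W p hKf.1 Wd hWd
  have hsp : SplitsIn K p := hKf.splitsIn_of_mult hE.2.1 (Ne.symm hqp)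
  have hsℓ : SplitsIn K ℓ := hKf.splitsIn_of_mult hmℓ hℓq
  have hmultd : Mult Wd p := htm hsp hE.2.1
  have hirrd : Irr Wd p := hti hE.2.2.1
  obtain ⟨hmℓd, hvℓd⟩ := htr ℓ hℓp hsℓ hmℓ hvℓ
  have hLd : Wd.entireLFunction 1 ≠ 0 := by
    rw [hWd_def, WeierstrassCurve.entireLFunction_smul]
    exact hKf.2.2.2.2
  exact bsdp_of_links W p hGZ hGZK hSk hE.1 hE.2.2.1 hr K hKf.1 Wd hWd hLd hmultd hirrd
    ⟨ℓ, hℓF, hℓp, hmℓd, hvℓd⟩ P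
    (hA W p q K Dt H ι P hE hr hqp hmq hnsq hvq hKf hDodd hP hc hnt)
    (gzParaphraseAt_of_datum W p hE.1 hGZK hmodE hCST hr hE.2.2.1 hmq hnsq hKf hsp Dt H ι P hP hc
      hnt Wd (Cd := C) rfl)
    (tamagawaDescentAt_of_isErratumField W p hE.1 q hmq hvq K hKf Wd hWd)

end EndForm

end Summit.BirchSwinnertonDyer.Rank1Residual.X11b

end
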